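import Literature.NumberTheory.FaltingsSerre.ParamodularTemplate
import HarnessLib

/-!
# The Faltings–Serre method after Brumer–Pacetti–Poor–Tornaría–Voight–Yuen, VII:
# the class-field block of a certificate depends only on the residual representation

[BPPTVY] = A. Brumer, A. Pacetti, C. Poor, G. Tornaría, J. Voight, D. S. Yuen, *On the paramodularity of
typical abelian surfaces*, Algebra & Number Theory **13**:5 (2019) 1145–1195 [cite: BrumerEtAl2019]
(PRINTED numbering and pages).

In Algorithm 2.4.1 (p. 1156) the input of Steps 2–4 — the field `K` cut out by the common residual
representation `ρ̄ = ρ̄₁ = ρ̄₂`, the extension data of Theorems 5.3.1/5.3.3, the core-free subfield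
`K₀`, the quadratic extensions of `K₀` unramified away from `S`, and the resulting finite set of
check primes — is the pair `(ρ̄, S)` alone; only Step 1 (residual equivalence) and Step 5 (trace
comparison at the check primes) look at the `ℓ`-adic representations themselves.  In the schema
`Certificate S P J ν ρ₁ ρ₂` of `ParamodularCertificate.lean` this is visible syntactically: the field
`complete` mentions `ρ₁` only through `residual ρ₁.toMonoidHom` (and `S`, `P`, `J mod ℓ`).

THIS FILE records the consequence as two kernel lemmas (no new notion, no cited fact):
* `Certificate.complete_of_residual_eq` — the Steps 2–4 block of a certificate for `(ρ₁, ρ₂)` IS the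
  Steps 2–4 block for any `ρ₁'` with `residual ρ₁' = residual ρ₁`;
* `Certificate.ofResidualEq` / `SurfaceCertificate.ofResidualEq` — a certificate for `(ρ₁, ρ₂)` plus
  the pair-specific data of a second pair `(ρ₁', ρ₂')` with the SAME residual representation
  (similitudes for the same `J, ν`, unramified outside `S`, `residual ρ₂' = residual ρ₁'`, and trace
  equality at the Frobenius elements above the SAME check set `P`) is a certificate for `(ρ₁', ρ₂')`.
So one class-field computation (one `complete` block, discharged outside the kernel) certifies every
pair of representations sharing its residual representation and its set `S` — e.g. (cell pub-paramod,
TARGETS.md Part D5) the two typical abelian surfaces of conductor `587`, whose `2`-division fields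
coincide, against the two nonlift newforms `f₅₈₇^∓` of [BPPTVY, §7.3] / [PoorYuen2015, Table 5]: the
printed check set `{3, 5, 7, 11, 13, 17, 19, 23, 29, 37, 41}` of [BPPTVY, Thm 7.3.1 pp. 1191–1192] serves both,
each pair supplying its own Step 1 and Step 5.  Nothing here is specific to `GSp₄` or `ℓ = 2`.

## References
* [BPPTVY] ANT 13:5 (2019): Algorithm 2.4.1 p. 1156 (Steps 1–5); Thm 7.3.1 pp. 1191–1192.
  [cite: BrumerEtAl2019]
-/

noncomputable section

namespace Literature.NumberTheory.FaltingsSerre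

open Matrix Field IsDedekindDomain
open Literature.NumberTheory.GaloisRepresentations
open scoped NumberField

section Transfer

variable {K : Type} [Field K] {ℓ : ℕ} [Fact ℓ.Prime] {n : ℕ}
  {S P : Set (HeightOneSpectrum (𝓞 K))} {J : Matrix (Fin n) (Fin n) ℤ_[ℓ]}
  {ν : absoluteGaloisGroup K → ℤ_[ℓ]} {ρ₁ ρ₂ ρ₁' ρ₂' : FramedGaloisRep K ℤ_[ℓ] n}

/-- **Steps 2–4 depend only on `ρ̄`.**  The `complete` block of a certificate for `(ρ₁, ρ₂)` — "every
admissible obstructing cocycle for `ρ̄₁` is obstructing at a Frobenius element above `P`" — holds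
verbatim for any `ρ₁'` with the same residual representation. [cite: BrumerEtAl2019, Algorithm 2.4.1 Steps 2–4 p. 1156] -/
theorem Certificate.complete_of_residual_eq (C : Certificate S P J ν ρ₁ ρ₂)
    (h : residual ρ₁'.toMonoidHom = residual ρ₁.toMonoidHom) :
    ∀ μ : absoluteGaloisGroup K → Matrix (Fin n) (Fin n) (ZMod ℓ), IsLocallyConstant μ →
      (∀ σ ∈ inertiaOutside K S, μ σ = 0) → ValuedIn (spLie (J.map (PadicInt.toZMod (p := ℓ)))) μ →
      IsDeviationCocycle (residual ρ₁'.toMonoidHom) μ → IsObstructing (residual ρ₁'.toMonoidHom) μ →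
      ∃ σ ∈ frobeniusAt K P, IsObstructingElt (residual ρ₁'.toMonoidHom) μ σ := by
  rw [h]
  exact C.complete

/-- Absolute irreducibility of the residual representation transfers along `residual ρ₁' = residual ρ₁`
(bookkeeping). [cite: BrumerEtAl2019, Algorithm 2.4.1 Step 1 p. 1156] -/
theorem Certificate.absIrreducible_of_residual_eq (C : Certificate S P J ν ρ₁ ρ₂)
    (h : residual ρ₁'.toMonoidHom = residual ρ₁.toMonoidHom) :
    IsAbsIrreducible (residual ρ₁'.toMonoidHom) := by
  rw [h]
  exact C.absIrreducible

/-- **One class-field computation, several pairs.**  A certificate for `(ρ₁, ρ₂)` with check set `P`,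
together with the pair-specific data of a second pair `(ρ₁', ρ₂')` sharing the residual
representation `ρ̄₁` — `J`-similitudes with the same multiplier `ν`, unramified outside the same `S`,
Step 1 (`residual ρ₂' = residual ρ₁'`) and Step 5 (equal traces at the Frobenius elements above `P`)
— is a certificate for `(ρ₁', ρ₂')`: Steps 2–4 are inherited (`Certificate.complete_of_residual_eq`).
[cite: BrumerEtAl2019, Algorithm 2.4.1 p. 1156; Thm 7.3.1 p. 1191] -/
theorem Certificate.ofResidualEq (C : Certificate S P J ν ρ₁ ρ₂)
    (h₁ : residual ρ₁'.toMonoidHom = residual ρ₁.toMonoidHom)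
    (h₂ : residual ρ₂'.toMonoidHom = residual ρ₁'.toMonoidHom)
    (hs₁ : ∀ σ, IsSimilitude J (ν σ) ((ρ₁' σ : GL (Fin n) ℤ_[ℓ]) : Matrix (Fin n) (Fin n) ℤ_[ℓ]))
    (hs₂ : ∀ σ, IsSimilitude J (ν σ) ((ρ₂' σ : GL (Fin n) ℤ_[ℓ]) : Matrix (Fin n) (Fin n) ℤ_[ℓ]))
    (hu₁ : ∀ v ∉ S, ρ₁'.IsUnramifiedAt v) (hu₂ : ∀ v ∉ S, ρ₂'.IsUnramifiedAt v)
    (ht : ∀ σ ∈ frobeniusAt K P, FramedRep.trace ρ₁' σ = FramedRep.trace ρ₂' σ) :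
    Certificate S P J ν ρ₁' ρ₂' where
  det_isUnit := C.det_isUnit
  transpose_eq := C.transpose_eq
  diag_eq := C.diag_eq
  similitude₁ := hs₁
  similitude₂ := hs₂
  residual_eq := h₂.symm
  absIrreducible := C.absIrreducible_of_residual_eq h₁
  unramified₁ := hu₁
  unramified₂ := hu₂
  complete := C.complete_of_residual_eq h₁
  traces := ht

/-- The symmetric special case used in practice: the SAME first representation is compared with a
second partner (`ρ₁' = ρ₁`; e.g. one abelian surface against two candidate forms), so only Step 1 and
Step 5 for the new partner are needed. [cite: BrumerEtAl2019, Algorithm 2.4.1 p. 1156] -/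
theorem Certificate.ofSecondPartner (C : Certificate S P J ν ρ₁ ρ₂)
    (h₂ : residual ρ₂'.toMonoidHom = residual ρ₁.toMonoidHom)
    (hs₂ : ∀ σ, IsSimilitude J (ν σ) ((ρ₂' σ : GL (Fin n) ℤ_[ℓ]) : Matrix (Fin n) (Fin n) ℤ_[ℓ]))
    (hu₂ : ∀ v ∉ S, ρ₂'.IsUnramifiedAt v)
    (ht : ∀ σ ∈ frobeniusAt K P, FramedRep.trace ρ₁ σ = FramedRep.trace ρ₂' σ) :
    Certificate S P J ν ρ₁ ρ₂' :=
  C.ofResidualEq rfl h₂ C.similitude₁ hs₂ C.unramified₁ hu₂ ht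

end Transfer

section Surface

variable {N : ℕ} {T : Finset ℕ} {J : Matrix (Fin 4) (Fin 4) ℤ_[2]}
  {ν : absoluteGaloisGroup ℚ → ℤ_[2]} {ρA ρf ρA' ρf' : FramedGaloisRep ℚ ℤ_[2] 4}

/-- **Level-`N` surface certificates with a shared residual representation.**  A surface certificate
of level `N` with check primes `T` for `(ρA, ρf)`, plus Step 1 / Step 5 and the side conditions for a
second pair `(ρA', ρf')` with `residual ρA' = residual ρA` (two abelian surfaces of conductor `N` with
the same `2`-division Galois module, each against its own paramodular form), is a surface certificate
of level `N` with the SAME check primes `T` for `(ρA', ρf')`.  Instance files then read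
`paramodular_of_surfaceCertificate_holds (C.ofResidualEq …) …` with no second class-field block.
[cite: BrumerEtAl2019, Algorithm 2.4.1 p. 1156; Thm 7.3.1 p. 1191] -/
theorem SurfaceCertificate.ofResidualEq (C : SurfaceCertificate N T J ν ρA ρf)
    (h₁ : residual ρA'.toMonoidHom = residual ρA.toMonoidHom)
    (h₂ : residual ρf'.toMonoidHom = residual ρA'.toMonoidHom)
    (hs₁ : ∀ σ, IsSimilitude J (ν σ) ((ρA' σ : GL (Fin 4) ℤ_[2]) : Matrix (Fin 4) (Fin 4) ℤ_[2]))
    (hs₂ : ∀ σ, IsSimilitude J (ν σ) ((ρf' σ : GL (Fin 4) ℤ_[2]) : Matrix (Fin 4) (Fin 4) ℤ_[2]))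
    (hu₁ : ∀ v ∉ placesOver (badPrimes N), ρA'.IsUnramifiedAt v)
    (hu₂ : ∀ v ∉ placesOver (badPrimes N), ρf'.IsUnramifiedAt v)
    (ht : ∀ σ ∈ frobeniusAt ℚ (placesOver T), FramedRep.trace ρA' σ = FramedRep.trace ρf' σ) :
    SurfaceCertificate N T J ν ρA' ρf' :=
  Certificate.ofResidualEq C h₁ h₂ hs₁ hs₂ hu₁ hu₂ ht

end Surface

end Literature.NumberTheory.FaltingsSerre
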